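/-
Copyright (c) 2026. All rights reserved.
Released under Apache 2.0 license as described in the file LICENSE.
-/
import Literature.AlgebraicGeometry.Pohlmann1968.MultiquadraticCMFieldRankFiveTypesHodgeConjecture
import Literature.AlgebraicGeometry.Pohlmann1968.MultiquadraticCMFieldWeightTwoTypesHodgeConjecture
import Literature.NumberTheory.ComplexMultiplication.DegenerateCMTypesElementaryAbelianOrderThirtyTwoStabilizers
import HarnessLib

/-!
# Multiquadratic CM fields of degree `32`: the rank spectrum `{2, 5, 9, 11, 17}`, imprimitive ⟺ rank `≤ 9`, and the
# Hodge conjecture for every power of every abelian variety whose CM type does not have rank `11`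

SETTING.  `K` a CM field, Galois over `ℚ` with `Gal(K/ℚ)` of exponent `2` and `[K:ℚ] = 32`
(`K = ℚ(√−d, √a₁, √a₂, √a₃, √a₄)`; `g = dim A = 16`), `Φ` a CM type, `Rank(Φ)` its Kubota rank (`= dim MT(A)`).
The field dress of the tree's group-level `DegenerateCMTypesElementaryAbelianOrderThirtyTwo` (seat p10 g38-#6: the
spectrum via the balance lemma) and `…OrderThirtyTwoStabilizers` (g38-#7: stabilisers per rank), on top of the
every-degree rank-`5` theorem of `MultiquadraticCMFieldRankFiveTypesHodgeConjecture` (g38-#9):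

> **Theorem** (`cmTypeRank_mem_of_finrank_eq_thirtytwo`).  `Rank(Φ) ∈ {2, 5, 9, 11, 17}`.
> **Theorem** (`exists_ne_one_comp_mem_iff_iff_cmTypeRank_le_nine`).  `Φg = Φ` for some `1 ≠ g ∈ Gal(K/ℚ)` iff
> `Rank(Φ) ≤ 9`; so the abelian varieties of type `(K; Φ)` are SIMPLE iff `Rank(Φ) ∈ {11, 17}`
> (`isSimple_iff_cmTypeRank_eq_eleven_or_seventeen`), and a simple DEGENERATE one has rank exactly `11`.
> **Theorem** (`hodgeConjectureFor_pow_of_cmTypeRank_ne_eleven`).  If `Rank(Φ) ≠ 11` then for EVERY realisation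
> `(A, ι, θ)` of `(K; Φ)` and every `n`: `Bᵐ(Aⁿ) ⊗ ℂ = Dᵐ(Aⁿ) ⊗ ℂ` for all `m`, and THE HODGE CONJECTURE HOLDS FOR
> `Aⁿ`.  In particular it holds for every power of every NON-SIMPLE abelian variety with complex multiplication by
> `K` (`hodgeConjectureFor_pow_of_not_isSimple_of_finrank_eq_thirtytwo`), and of every simple one of nondegenerate type.

Mechanism for `Rank ≠ 11`: rank `17` is nondegenerate (Hazama–Murty, tree
`IsNondegenerate.hodgeClassSpan_pow_eq_divisorClassesSpan`); rank `2` is the tree's `CMTypeRankTwo`; rank `9` ⟹ a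
`g ≠ 1` stabilises `Φ` ⟹ `Φ = Ψ^K` with `Ψ` on a subfield of degree `16` and `Rank(Ψ) = 9 = 16/2 + 1`,
NONDEGENERATE (`exists_inducedCMType_sixteen_of_cmTypeRank_eq_nine_of_finrank_eq_thirtytwo`); rank `5` ⟹ the
every-degree theorem (induced from a nondegenerate octic type); then Pohlmann–Hazama transfer along `Φ = Ψ^K` (tree
`IsNondegenerate.hodgeClassSpan_pow_eq_divisorClassesSpan_inducedCMType`; B. B. Gordon [Gordon1999HodgeAVSurvey]
Thm. 6.4, §9.3).  HONEST FRONTIER: the rank-`11` types are primitive and degenerate — their (simple,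
`16`-dimensional) abelian varieties carry exceptional Hodge classes on some power (Pohlmann; not treated here), and
the Hodge conjecture for them is NOT addressed by this file; the existence of types of each rank is a computation
not formalised here.

* §1 `cmTypeRank_mem_of_finrank_eq_thirtytwo`, `cmTypeRank_ne_six/eight/fourteen_of_finrank_eq_thirtytwo`.
* §1′ (every degree `≥ 16`) **`five_lt_cmTypeRank_of_isPrimitive`**, `five_lt_cmTypeRank_of_isSimple`.
* §2 `exists_ne_one_comp_mem_iff_of_cmTypeRank_le_nine`, **`exists_ne_one_comp_mem_iff_iff_cmTypeRank_le_nine`**,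
  `not_isPrimitive_of_cmTypeRank_le_nine`, `cmTypeRank_eq_eleven_or_seventeen_of_isPrimitive`,
  `forall_comp_mem_iff_eq_one_of_nine_lt_cmTypeRank`, **`isSimple_iff_cmTypeRank_eq_eleven_or_seventeen`**,
  `cmTypeRank_eq_eleven_of_isSimple_of_not_isNondegenerate`.
* §3 `exists_inducedCMType_sixteen_of_cmTypeRank_eq_nine_of_finrank_eq_thirtytwo`.
* §4 **`hodgeClassSpan_pow_eq_divisorClassesSpan_of_cmTypeRank_ne_eleven`**,
  **`hodgeConjectureFor_pow_of_cmTypeRank_ne_eleven`**, `hodgeConjectureFor_pow_of_not_isSimple_of_finrank_eq_thirtytwo`,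
  `hodgeClasses_algebraic_pow_of_cmTypeRank_ne_eleven`, `not_exists_exceptional_pow_of_cmTypeRank_ne_eleven`.

HONEST SCOPE.  Assemblies of tree theorems with the seat's group-level spectrum; no named fact.  THEOREMS ONLY: no
definition, no named fact, no instance, no `sorry`.

## References

* [Kubota1965] T. Kubota, *On the field extension by complex multiplication*, Trans. AMS 118 (1965), §2, §4 Lemma 2.
* [Gordon1999HodgeAVSurvey] B. B. Gordon, *A survey of the Hodge conjecture for abelian varieties*, Prop. 9.4.1,
  Thm. 6.4, §9.3.
* [Dodson1984] B. Dodson, *The structure of Galois groups of CM-fields*, Trans. AMS 283 (1984), §3.1.1, §3.2.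
* [Shimura1998] G. Shimura, *Abelian Varieties with Complex Multiplication and Modular Functions*, §8.2 Prop. 26,
  §8.4 Example (1).
* [BCLLMNO2015] Bouw–Cooley–Lauter–Lorenzo García–Manes–Newton–Ozman, §3 Prop. 3.3 (induced CM types).
* [Lang1983ComplexMultiplication] S. Lang, *Complex Multiplication*, Ch. I Thm. 3.6.

## Provenance

Lane `lit-hodgefound` (Track 2, Layer A4/A5), seat `lit-hodgefound-p10` generation 38, row g38-#10; neighbours cited by
name, nothing restated: `DegenerateCMTypesElementaryAbelianOrderThirtyTwo` (`typeRank_mem_of_card_thirtytwo`),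
`DegenerateCMTypesElementaryAbelianOrderThirtyTwoStabilizers` (`exists_ne_one_forall_mul_mem_iff_iff_typeRank_le_nine`),
`MultiquadraticCMFieldRankFiveTypesHodgeConjecture` (`isAbelianGalois_of_forall_sq_eq_one`, `comp_mem_iff_iff_forall_mul_mem_iff`,
`cmTypeRank_le_of_comp_mem_iff`, `hodgeClassSpan_pow_eq_divisorClassesSpan_of_cmTypeRank_eq_five`,
`not_isPrimitive_of_cmTypeRank_eq_five_of_sixteen_le`, `hodgeConjectureFor_of_forall_hodgeClassSpan_eq_divisorClassesSpan`),
`MultiquadraticCMFieldWeightTwoTypesHodgeConjecture` (`cmTypeRank_eq_two_or_five_le`), `GaloisOcticCMFieldAllPowersHodgeConjecture`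
(`not_isPrimitive_of_cmTypeRank_eq_two`, `not_isPrimitive_of_comp_mem_iff`), `CMTypeRankTwo` (`hodgeClassSpan_pow_eq_divisorClassesSpan_of_cmTypeRank_eq_two`),
`CMTypeEquivalenceClassesCount` (`mem_twistStabilizer_iff`, `exists_inducedCMType_of_twist_eq`,
`pattern_primitive_iff_twistStabilizer_eq_bot`), `CMTypeRankInducedType` (`cmTypeRank_inducedCMType`),
`NondegenerateCMTypeDivisorClasses` (`IsNondegenerate.hodgeClassSpan_pow_eq_divisorClassesSpan`, `cmTypeRank_le`,
`isNondegenerate_iff`), `NonSimpleCMAbelianVarietyHazamaCriterion`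
(`IsNondegenerate.hodgeClassSpan_pow_eq_divisorClassesSpan_inducedCMType`), `SimpleIffPrimitiveCMType`
(`isSimple_iff_isPrimitive`), `PrimitiveCMTypeSimple` (`isPrimitive_ringEquiv_complex_iff`).
-/

open scoped BigOperators NumberField IsMulCommutative Classical
open NumberField Module CategoryTheory CategoryTheory.Limits IntermediateField

namespace Literature.AlgebraicGeometry.Pohlmann1968

namespace Multiquadratic

-- `open scoped`: the tree's action of `Aut(ℂ)` on `Hom(K, ℂ)` by composition is a scoped instance
open scoped Literature.NumberTheory.ComplexMultiplication
open Literature.NumberTheory.ComplexMultiplication (IsPrimitive inducedCMType typeRank mem_inducedCMType_iff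
  exists_inducedCMType_of_twist_eq isCMField_of_cmType_intermediateField twistStabilizer mem_twistStabilizer_iff
  exists_eq_inducedCMType_fixedField_of_le_twistStabilizer pattern_primitive_iff_twistStabilizer_eq_bot conjGal
  conjGal_mul_conjGal)
open Literature.NumberTheory.ComplexMultiplication.CMNumbers
open Literature.AlgebraicGeometry.Motives (CMType AbelianVariety)
open Literature.AlgebraicGeometry.HodgeTheory
open Literature.AlgebraicGeometry.VanGeemen1994 (hodgeClassSpan)
open Literature.Barriers.HodgeConjecture (divisorClassesSpan)
open Literature.AlgebraicGeometry.ComplexMultiplication (IsCMTypeRealisation isSimple_iff_isPrimitive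
  isPrimitive_ringEquiv_complex_iff)
open Literature.AlgebraicGeometry.Pohlmann1968.CyclicTwoOddPrimes (isCMTypeWith_galType cmTypeRank_eq_typeRank_galType)
open Literature.AlgebraicGeometry.Pohlmann1968.AbelianKernels

variable {K : Type} [Field K] [NumberField K] [IsCMField K] [IsGalois ℚ K]
  {A : AbelianVariety ℂ} {ι : 𝓞 K →+* End A} {θ : K →+* Module.End ℂ (complexBetti A.X 1)}

/-! ## §0 Helper -/

section Helpers

omit [IsCMField K] [IsGalois ℚ K] in
/-- `g.symm = g` for `g² = 1`. [folklore] -/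
private theorem symm_eq_self_of_sq_t (hexp : ∀ g : K ≃ₐ[ℚ] K, g ^ 2 = 1) (g : K ≃ₐ[ℚ] K) : g.symm = g := by
  rw [← AlgEquiv.aut_inv]
  exact inv_eq_of_mul_eq_one_right (by rw [← pow_two]; exact hexp g)

end Helpers

/-! ## §1 The rank spectrum -/

section Spectrum

/-- **`[K:ℚ] = 32` MULTIQUADRATIC: `Rank(Φ) ∈ {17, 11, 9, 5, 2}`** for EVERY CM type (the balance lemma rules out
`6, 8, 14`). [cite: Kubota1965, §4 Lemma 2] [cite: Dodson1984, §3.1.1 Theorem] -/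
theorem cmTypeRank_mem_of_finrank_eq_thirtytwo (hexp : ∀ g : K ≃ₐ[ℚ] K, g ^ 2 = 1) (h32 : finrank ℚ K = 32)
    (Φ : CMType K) :
    cmTypeRank Φ = 17 ∨ cmTypeRank Φ = 11 ∨ cmTypeRank Φ = 9 ∨ cmTypeRank Φ = 5 ∨ cmTypeRank Φ = 2 := by
  haveI := isAbelianGalois_of_forall_sq_eq_one hexp
  obtain ⟨φ₀⟩ := (inferInstance : Nonempty (K →+* ℂ))
  rw [cmTypeRank_eq_typeRank_galType Φ φ₀]
  exact Literature.NumberTheory.ComplexMultiplication.CyclicCMType.ExponentTwo.typeRank_mem_of_card_thirtytwo hexp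
    (isCMTypeWith_galType (AbelianCMFieldExistence.apply_conjGal_eq φ₀) Φ) (by rw [card_gal_eq_finrank φ₀, h32])

/-- `[K:ℚ] = 32`: no CM type of rank `6`. [cite: Kubota1965, §4 Lemma 2] -/
theorem cmTypeRank_ne_six_of_finrank_eq_thirtytwo (hexp : ∀ g : K ≃ₐ[ℚ] K, g ^ 2 = 1) (h32 : finrank ℚ K = 32)
    (Φ : CMType K) : cmTypeRank Φ ≠ 6 := by
  rcases cmTypeRank_mem_of_finrank_eq_thirtytwo hexp h32 Φ with h | h | h | h | h <;> omega

/-- `[K:ℚ] = 32`: no CM type of rank `8`. [cite: Kubota1965, §4 Lemma 2] -/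
theorem cmTypeRank_ne_eight_of_finrank_eq_thirtytwo (hexp : ∀ g : K ≃ₐ[ℚ] K, g ^ 2 = 1) (h32 : finrank ℚ K = 32)
    (Φ : CMType K) : cmTypeRank Φ ≠ 8 := by
  rcases cmTypeRank_mem_of_finrank_eq_thirtytwo hexp h32 Φ with h | h | h | h | h <;> omega

/-- `[K:ℚ] = 32`: no CM type of rank `14`. [cite: Kubota1965, §4 Lemma 2] -/
theorem cmTypeRank_ne_fourteen_of_finrank_eq_thirtytwo (hexp : ∀ g : K ≃ₐ[ℚ] K, g ^ 2 = 1)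
    (h32 : finrank ℚ K = 32) (Φ : CMType K) : cmTypeRank Φ ≠ 14 := by
  rcases cmTypeRank_mem_of_finrank_eq_thirtytwo hexp h32 Φ with h | h | h | h | h <;> omega

end Spectrum

/-! ## §1′ Every degree `≥ 16`: a primitive type (a simple abelian variety) has rank `> 5` -/

section EveryDegree

/-- **A PRIMITIVE CM TYPE OF A MULTIQUADRATIC CM FIELD OF DEGREE `≥ 16` HAS RANK `> 5`**: ranks `3, 4` never occur
(Titsworth, tree `cmTypeRank_eq_two_or_five_le`), rank `2` is induced from an imaginary quadratic subfield (tree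
`not_isPrimitive_of_cmTypeRank_eq_two`) and rank `5` from an octic subfield (tree
`not_isPrimitive_of_cmTypeRank_eq_five_of_sixteen_le`). [cite: Kubota1965, §2 and §4 Lemma 2] [cite: Shimura1998, §8.2 Prop. 26] -/
theorem five_lt_cmTypeRank_of_isPrimitive (hexp : ∀ g : K ≃ₐ[ℚ] K, g ^ 2 = 1) (h16 : 16 ≤ finrank ℚ K)
    (Φ : CMType K) (φ₀ : K →+* ℂ) (hprim : IsPrimitive (ℂ ≃+* ℂ) Φ.1 φ₀) : 5 < cmTypeRank Φ := by
  rcases cmTypeRank_eq_two_or_five_le hexp Φ with h2 | h5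
  · exact absurd hprim (not_isPrimitive_of_cmTypeRank_eq_two hexp (by omega) Φ φ₀ h2)
  · rcases Nat.lt_or_eq_of_le h5 with hlt | heq
    · exact hlt
    · exact absurd hprim (not_isPrimitive_of_cmTypeRank_eq_five_of_sixteen_le hexp h16 Φ φ₀ heq.symm)

/-- **A SIMPLE ABELIAN VARIETY WITH COMPLEX MULTIPLICATION BY A MULTIQUADRATIC CM FIELD OF DEGREE `≥ 16` HAS
MUMFORD–TATE RANK `> 5`** (simple ⟺ primitive, tree `isSimple_iff_isPrimitive`). [cite: Shimura1998, §8.2 Prop. 26]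
[cite: Kubota1965, §4 Lemma 2] -/
theorem five_lt_cmTypeRank_of_isSimple (hexp : ∀ g : K ≃ₐ[ℚ] K, g ^ 2 = 1) (h16 : 16 ≤ finrank ℚ K)
    (Φ : CMType K) (hA : IsCMTypeRealisation Φ A ι θ) (hs : A.IsSimple) : 5 < cmTypeRank Φ := by
  obtain ⟨φ₀⟩ : Nonempty (K →+* ℂ) := inferInstance
  exact five_lt_cmTypeRank_of_isPrimitive hexp h16 Φ φ₀ ((isSimple_iff_isPrimitive hA φ₀).1 hs)

end EveryDegree

/-! ## §2 Stabilisers, primitivity, simplicity -/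

section Stabilizers

/-- **`Rank(Φ) ≤ 9` ⟹ `Φg = Φ` for some `g ≠ 1`** (`[K:ℚ] = 32`). [cite: Kubota1965, §4 Lemma 2] [cite: Dodson1984, §3.1.1 Theorem] -/
theorem exists_ne_one_comp_mem_iff_of_cmTypeRank_le_nine (hexp : ∀ g : K ≃ₐ[ℚ] K, g ^ 2 = 1)
    (h32 : finrank ℚ K = 32) (Φ : CMType K) (hr : cmTypeRank Φ ≤ 9) :
    ∃ g : K ≃ₐ[ℚ] K, g ≠ 1 ∧ ∀ φ : K →+* ℂ, φ.comp (g : K →+* K) ∈ Φ.1 ↔ φ ∈ Φ.1 := by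
  haveI := isAbelianGalois_of_forall_sq_eq_one hexp
  obtain ⟨φ₀⟩ := (inferInstance : Nonempty (K →+* ℂ))
  have hcm := isCMTypeWith_galType (AbelianCMFieldExistence.apply_conjGal_eq φ₀) Φ
  rw [cmTypeRank_eq_typeRank_galType Φ φ₀] at hr
  obtain ⟨g, hg1, hstab⟩ :=
    (Literature.NumberTheory.ComplexMultiplication.CyclicCMType.ExponentTwo.exists_ne_one_forall_mul_mem_iff_iff_typeRank_le_nine
      hexp hcm (by rw [card_gal_eq_finrank φ₀, h32])).2 hr
  exact ⟨g, hg1, (comp_mem_iff_iff_forall_mul_mem_iff hexp φ₀ Φ g).2 hstab⟩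

/-- **`[K:ℚ] = 32`: `Φ` HAS A NON-TRIVIAL STABILISER ⟺ `Rank(Φ) ≤ 9`** (⟺ `Rank(Φ) ∈ {2, 5, 9}`).
[cite: Kubota1965, §2 and §4 Lemma 2] [cite: Dodson1984, §3.1.1 Theorem] -/
theorem exists_ne_one_comp_mem_iff_iff_cmTypeRank_le_nine (hexp : ∀ g : K ≃ₐ[ℚ] K, g ^ 2 = 1)
    (h32 : finrank ℚ K = 32) (Φ : CMType K) :
    (∃ g : K ≃ₐ[ℚ] K, g ≠ 1 ∧ ∀ φ : K →+* ℂ, φ.comp (g : K →+* K) ∈ Φ.1 ↔ φ ∈ Φ.1) ↔ cmTypeRank Φ ≤ 9 := by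
  constructor
  · rintro ⟨g, hg1, hstab⟩
    have := cmTypeRank_le_of_comp_mem_iff hexp Φ hg1 hstab
    rw [h32] at this
    exact this
  · exact exists_ne_one_comp_mem_iff_of_cmTypeRank_le_nine hexp h32 Φ

/-- **`[K:ℚ] = 32`: `Rank(Φ) ≤ 9` ⟹ `Φ` is NOT primitive.** [cite: Shimura1998, §8.2 Prop. 26] [cite: Kubota1965, §4 Lemma 2] -/
theorem not_isPrimitive_of_cmTypeRank_le_nine (hexp : ∀ g : K ≃ₐ[ℚ] K, g ^ 2 = 1) (h32 : finrank ℚ K = 32)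
    (Φ : CMType K) (φ₀ : K →+* ℂ) (hr : cmTypeRank Φ ≤ 9) : ¬ IsPrimitive (ℂ ≃+* ℂ) Φ.1 φ₀ := by
  obtain ⟨g, hg1, hstab⟩ := exists_ne_one_comp_mem_iff_of_cmTypeRank_le_nine hexp h32 Φ hr
  exact not_isPrimitive_of_comp_mem_iff Φ φ₀ hg1 hstab

/-- **`[K:ℚ] = 32`: `Φ` PRIMITIVE ⟹ `Rank(Φ) ∈ {11, 17}`.** [cite: Shimura1998, §8.2 Prop. 26] [cite: Kubota1965, §4 Lemma 2] -/
theorem cmTypeRank_eq_eleven_or_seventeen_of_isPrimitive (hexp : ∀ g : K ≃ₐ[ℚ] K, g ^ 2 = 1)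
    (h32 : finrank ℚ K = 32) (Φ : CMType K) (φ₀ : K →+* ℂ) (hprim : IsPrimitive (ℂ ≃+* ℂ) Φ.1 φ₀) :
    cmTypeRank Φ = 11 ∨ cmTypeRank Φ = 17 := by
  have hnot : ¬ cmTypeRank Φ ≤ 9 := fun hle => not_isPrimitive_of_cmTypeRank_le_nine hexp h32 Φ φ₀ hle hprim
  rcases cmTypeRank_mem_of_finrank_eq_thirtytwo hexp h32 Φ with h | h | h | h | h <;> omega

/-- **`[K:ℚ] = 32`: a NONDEGENERATE or rank-`11` type is primitive** — no `g ≠ 1` stabilises it (`Rank > 9`).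
[cite: Kubota1965, §2 and §4 Lemma 2] -/
theorem forall_comp_mem_iff_eq_one_of_nine_lt_cmTypeRank (hexp : ∀ g : K ≃ₐ[ℚ] K, g ^ 2 = 1)
    (h32 : finrank ℚ K = 32) (Φ : CMType K) (hr : 9 < cmTypeRank Φ) {g : K ≃ₐ[ℚ] K}
    (hstab : ∀ φ : K →+* ℂ, φ.comp (g : K →+* K) ∈ Φ.1 ↔ φ ∈ Φ.1) : g = 1 := by
  by_contra hg1
  have := (exists_ne_one_comp_mem_iff_iff_cmTypeRank_le_nine hexp h32 Φ).1 ⟨g, hg1, hstab⟩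
  omega

/-- **`[K:ℚ] = 32`: `A` SIMPLE ⟺ `Rank(Φ) ∈ {11, 17}`** for every abelian variety of type `(K; Φ)` (simple ⟺
primitive, tree `isSimple_iff_isPrimitive`; primitive ⟺ twist stabiliser trivial ⟺ rank `> 9`).
[cite: Shimura1998, §8.2 Prop. 26] [cite: Kubota1965, §2 and §4 Lemma 2] -/
theorem isSimple_iff_cmTypeRank_eq_eleven_or_seventeen (hexp : ∀ g : K ≃ₐ[ℚ] K, g ^ 2 = 1)
    (h32 : finrank ℚ K = 32) (Φ : CMType K) (hA : IsCMTypeRealisation Φ A ι θ) :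
    A.IsSimple ↔ cmTypeRank Φ = 11 ∨ cmTypeRank Φ = 17 := by
  obtain ⟨φ₀⟩ : Nonempty (K →+* ℂ) := inferInstance
  rw [isSimple_iff_isPrimitive hA φ₀]
  constructor
  · exact cmTypeRank_eq_eleven_or_seventeen_of_isPrimitive hexp h32 Φ φ₀
  · intro hr
    -- primitive ⟺ no induced structure ⟺ trivial twist stabiliser
    rw [isPrimitive_ringEquiv_complex_iff, pattern_primitive_iff_twistStabilizer_eq_bot]
    rw [Subgroup.eq_bot_iff_forall]
    intro g hg
    have hstab : ∀ φ : K →+* ℂ, φ.comp (g : K →+* K) ∈ Φ.1 ↔ φ ∈ Φ.1 := by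
      intro φ
      have hΦ : inducedCMType (g.symm : K →+* K) Φ = Φ := (mem_twistStabilizer_iff Φ g).1 hg
      have h1 : φ ∈ (inducedCMType (g.symm : K →+* K) Φ).1 ↔ φ ∈ Φ.1 := by rw [hΦ]
      rwa [mem_inducedCMType_iff, symm_eq_self_of_sq_t hexp g] at h1
    exact forall_comp_mem_iff_eq_one_of_nine_lt_cmTypeRank hexp h32 Φ (by omega) hstab

/-- **`[K:ℚ] = 32`: a SIMPLE abelian `16`-fold with CM by `K` whose type is DEGENERATE has Mumford–Tate rank
exactly `11`** (defect `6`). [cite: Kubota1965, §4 Lemma 2] [cite: Dodson1984, §3.2 Theorem 3.2.1] -/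
theorem cmTypeRank_eq_eleven_of_isSimple_of_not_isNondegenerate (hexp : ∀ g : K ≃ₐ[ℚ] K, g ^ 2 = 1)
    (h32 : finrank ℚ K = 32) (Φ : CMType K) (hA : IsCMTypeRealisation Φ A ι θ) (hs : A.IsSimple)
    (hnd : ¬ IsNondegenerate Φ) : cmTypeRank Φ = 11 := by
  rcases (isSimple_iff_cmTypeRank_eq_eleven_or_seventeen hexp h32 Φ hA).1 hs with h | h
  · exact h
  · exfalso
    apply hnd
    rw [_root_.Literature.AlgebraicGeometry.Pohlmann1968.isNondegenerate_iff, h32, h]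

end Stabilizers

/-! ## §3 Imprimitive types are induced from NONDEGENERATE types -/

section Induced

/-- **`[K:ℚ] = 32`, `Rank(Φ) = 9` ⟹ `Φ = Ψ^K` for a NONDEGENERATE CM type `Ψ` of a subfield of degree `16`**
(`Rank(Ψ) = 9 ≤ [k:ℚ]/2 + 1` forces `[k:ℚ] = 16`). [cite: BCLLMNO2015, §3 Prop. 3.3] [cite: Kubota1965, §4 Lemma 2] -/
theorem exists_inducedCMType_sixteen_of_cmTypeRank_eq_nine_of_finrank_eq_thirtytwo (hexp : ∀ g : K ≃ₐ[ℚ] K, g ^ 2 = 1)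
    (h32 : finrank ℚ K = 32) (Φ : CMType K) (hr : cmTypeRank Φ = 9) :
    ∃ (k : IntermediateField ℚ K) (Ψ : CMType k), finrank ℚ k = 16 ∧ inducedCMType (algebraMap k K) Ψ = Φ ∧
      ∃ _ : IsCMField k, IsNondegenerate Ψ := by
  obtain ⟨g, hg1, hstab⟩ := exists_ne_one_comp_mem_iff_of_cmTypeRank_le_nine hexp h32 Φ (by rw [hr])
  have htwist : inducedCMType (g.symm : K →+* K) Φ = Φ := by
    apply Subtype.ext
    ext φ
    rw [mem_inducedCMType_iff, symm_eq_self_of_sq_t hexp g]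
    exact hstab φ
  obtain ⟨k, Ψ, hk, hΨ⟩ := exists_inducedCMType_of_twist_eq hg1 htwist
  haveI hCM : IsCMField k := isCMField_of_cmType_intermediateField k Ψ
  have hrΨ : cmTypeRank Ψ = 9 := by rw [← cmTypeRank_inducedCMType (algebraMap k K) Ψ, hΨ, hr]
  have hle : cmTypeRank Ψ ≤ finrank ℚ k / 2 + 1 := cmTypeRank_le Ψ
  have hmul : finrank ℚ k * finrank k K = finrank ℚ K := Module.finrank_mul_finrank ℚ k K
  have hkK : finrank k K ≠ 1 := fun h1 => hk (IntermediateField.finrank_eq_one_iff_eq_top.1 h1)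
  have hkK0 : 0 < finrank k K := Module.finrank_pos
  have h16 : finrank ℚ k = 16 := by
    rw [h32] at hmul
    rw [hrΨ] at hle
    have hge : 16 ≤ finrank ℚ k := by omega
    have hm2 : 2 ≤ finrank k K := by omega
    nlinarith
  refine ⟨k, Ψ, h16, hΨ, hCM, ?_⟩
  rw [_root_.Literature.AlgebraicGeometry.Pohlmann1968.isNondegenerate_iff, h16, hrΨ]

end Induced

/-! ## §4 The Hodge conjecture for every power, unless the rank is `11` -/

section Hodge

/-- **`Bᵐ(Aⁿ) ⊗ ℂ = Dᵐ(Aⁿ) ⊗ ℂ` FOR ALL `n, m`, FOR EVERY ABELIAN VARIETY WITH CM BY A MULTIQUADRATIC CM FIELD OF DEGREE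
`32` WHOSE TYPE DOES NOT HAVE RANK `11`** (rank `17`: nondegenerate; `9`, `5`: induced from nondegenerate types of
subfields of degree `16`, `8`; `2`: the tree's rank-two theorem). [cite: Gordon1999HodgeAVSurvey, Thm. 6.4 and §9.3]
[cite: Kubota1965, §4 Lemma 2] -/
theorem hodgeClassSpan_pow_eq_divisorClassesSpan_of_cmTypeRank_ne_eleven (hexp : ∀ g : K ≃ₐ[ℚ] K, g ^ 2 = 1)
    (h32 : finrank ℚ K = 32) (Φ : CMType K) (h11 : cmTypeRank Φ ≠ 11) (hA : IsCMTypeRealisation Φ A ι θ)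
    (n m : ℕ) :
    hodgeClassSpan (⨁ fun _ : Fin n => A).dim (⨁ fun _ : Fin n => A).X m =
      divisorClassesSpan (⨁ fun _ : Fin n => A).X (⨁ fun _ : Fin n => A).dim m := by
  rcases cmTypeRank_mem_of_finrank_eq_thirtytwo hexp h32 Φ with h17 | h | h9 | h5 | h2
  · have hnd : IsNondegenerate Φ := by
      rw [_root_.Literature.AlgebraicGeometry.Pohlmann1968.isNondegenerate_iff, h32, h17]
    exact hnd.hodgeClassSpan_pow_eq_divisorClassesSpan hA n m
  · exact absurd h h11
  · obtain ⟨k, Ψ, -, hΨ, hCM, hnd⟩ := exists_inducedCMType_sixteen_of_cmTypeRank_eq_nine_of_finrank_eq_thirtytwo hexp h32 Φ h9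
    haveI := hCM
    exact hnd.hodgeClassSpan_pow_eq_divisorClassesSpan_inducedCMType hΨ hA n m
  · exact hodgeClassSpan_pow_eq_divisorClassesSpan_of_cmTypeRank_eq_five hexp Φ h5 hA n m
  · exact hodgeClassSpan_pow_eq_divisorClassesSpan_of_cmTypeRank_eq_two Φ h2 hA n m

/-- **THE HODGE CONJECTURE FOR EVERY POWER OF EVERY ABELIAN VARIETY WITH COMPLEX MULTIPLICATION BY A MULTIQUADRATIC CM
FIELD OF DEGREE `32` WHOSE CM TYPE DOES NOT HAVE RANK `11`, UNCONDITIONALLY** (`Φ` any such type, `(A, ι, θ)` ANY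
realisation read on `H¹`, every `n`).  The rank-`11` types (primitive, degenerate) are the honest frontier.
[cite: Gordon1999HodgeAVSurvey, Thm. 6.4 and §9.3] [cite: Kubota1965, §4 Lemma 2] [cite: Dodson1984, §3.1.1 Theorem] -/
theorem hodgeConjectureFor_pow_of_cmTypeRank_ne_eleven (hexp : ∀ g : K ≃ₐ[ℚ] K, g ^ 2 = 1) (h32 : finrank ℚ K = 32)
    (Φ : CMType K) (h11 : cmTypeRank Φ ≠ 11) (hA : IsCMTypeRealisation Φ A ι θ) (n : ℕ) :
    HodgeConjectureFor (⨁ fun _ : Fin n => A).dim (⨁ fun _ : Fin n => A).X :=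
  hodgeConjectureFor_of_forall_hodgeClassSpan_eq_divisorClassesSpan _
    (fun m => hodgeClassSpan_pow_eq_divisorClassesSpan_of_cmTypeRank_ne_eleven hexp h32 Φ h11 hA n m)

/-- **THE HODGE CONJECTURE FOR EVERY POWER OF EVERY NON-SIMPLE ABELIAN VARIETY WITH COMPLEX MULTIPLICATION BY A
MULTIQUADRATIC CM FIELD OF DEGREE `32`** (non-simple ⟹ rank `≤ 9 ≠ 11`). [cite: Gordon1999HodgeAVSurvey, Thm. 6.4 and §9.3]
[cite: Shimura1998, §8.2 Prop. 26] -/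
theorem hodgeConjectureFor_pow_of_not_isSimple_of_finrank_eq_thirtytwo (hexp : ∀ g : K ≃ₐ[ℚ] K, g ^ 2 = 1) (h32 : finrank ℚ K = 32)
    (Φ : CMType K) (hA : IsCMTypeRealisation Φ A ι θ) (hs : ¬ A.IsSimple) (n : ℕ) :
    HodgeConjectureFor (⨁ fun _ : Fin n => A).dim (⨁ fun _ : Fin n => A).X := by
  refine hodgeConjectureFor_pow_of_cmTypeRank_ne_eleven hexp h32 Φ (fun h11 => hs ?_) hA n
  exact (isSimple_iff_cmTypeRank_eq_eleven_or_seventeen hexp h32 Φ hA).2 (Or.inl h11)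

/-- **Every Hodge class on every power is algebraic** (`Rank(Φ) ≠ 11`). [cite: Gordon1999HodgeAVSurvey, Thm. 6.4 and §9.3] -/
theorem hodgeClasses_algebraic_pow_of_cmTypeRank_ne_eleven (hexp : ∀ g : K ≃ₐ[ℚ] K, g ^ 2 = 1)
    (h32 : finrank ℚ K = 32) (Φ : CMType K) (h11 : cmTypeRank Φ ≠ 11) (hA : IsCMTypeRealisation Φ A ι θ)
    (n m : ℕ) (c : complexBetti (⨁ fun _ : Fin n => A).X (2 * m)) (hcQ : IsRationalClass c)
    (hcH : IsOfHodgeType (⨁ fun _ : Fin n => A).dim (⨁ fun _ : Fin n => A).X (2 * m) m m c) :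
    c ∈ algebraicClasses (⨁ fun _ : Fin n => A).X m :=
  (hodgeConjectureFor_pow_of_cmTypeRank_ne_eleven hexp h32 Φ h11 hA n).2 m c hcQ hcH

/-- **No power carries an exceptional Hodge class** (`Rank(Φ) ≠ 11`). [cite: Gordon1999HodgeAVSurvey, Thm. 6.4 and §9.3] -/
theorem not_exists_exceptional_pow_of_cmTypeRank_ne_eleven (hexp : ∀ g : K ≃ₐ[ℚ] K, g ^ 2 = 1)
    (h32 : finrank ℚ K = 32) (Φ : CMType K) (h11 : cmTypeRank Φ ≠ 11) (hA : IsCMTypeRealisation Φ A ι θ)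
    (n m : ℕ) :
    ¬ ∃ c : complexBetti (⨁ fun _ : Fin n => A).X (2 * m), IsRationalClass c ∧
        IsOfHodgeType (⨁ fun _ : Fin n => A).dim (⨁ fun _ : Fin n => A).X (2 * m) m m c ∧
        c ∉ divisorClassesSpan (⨁ fun _ : Fin n => A).X (⨁ fun _ : Fin n => A).dim m := by
  rintro ⟨c, hcQ, hcH, hcD⟩
  exact hcD ((hodgeClassSpan_pow_eq_divisorClassesSpan_of_cmTypeRank_ne_eleven hexp h32 Φ h11 hA n m) ▸
    Submodule.subset_span ⟨hcQ, hcH⟩)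

end Hodge

end Multiquadratic

end Literature.AlgebraicGeometry.Pohlmann1968
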